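import Literature.AlgebraicGeometry.HodgeTheory.ConjugationChartExistence
import Literature.AlgebraicGeometry.HodgeTheory.JouanolouDeviceHolds
import Literature.AlgebraicGeometry.HodgeTheory.ConjRealizeReadout
import Literature.AlgebraicGeometry.HodgeTheory.AlgFormExprCalculus
import Literature.AlgebraicGeometry.Motives.ConjugateVarietyPointEval
import Literature.NumberTheory.Transcendental.AnalytificationCotangentChart
import Literature.NumberTheory.Transcendental.AnalytificationSecondCountableProofs
import HarnessLib

/-!
# Conjugation preserves closedness of realised algebraic forms (proof file)

This file discharges the named fact (C) `conj_realize_mem_cclosedSmoothForms` of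
`HodgeTheory/ConjugationChartExistence` (`conj_realize_mem_cclosedSmoothForms_holds`): for `Y` smooth
affine over `ℂ`, analytic models `A` of `Y` and `A'` of the conjugate variety `Y^σ`, and an algebraic
`k`-form expression `ξ = ∑ⱼ fⱼ dg_{j,1} ∧ ⋯ ∧ dg_{j,k}` on `Y` (`AlgFormExpr`), if the realisation
`ξ.realize A` on `Y^an` is closed then so is the realisation `(ξ^σ).realize A'` of the conjugate
expression on `(Y^σ)^an`. This is Charles–Schnell, *Notes on absolute Hodge classes*, §11.2.2,
(11.2.2): `α ↦ α^σ` is an isomorphism of the algebraic de Rham COMPLEXES, together with the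
injectivity of algebraic into analytic differential forms on a smooth variety (Serre, GAGA §2 n°6
Cor. 2; Grothendieck 1966, §1). It is the final assembly of inputs already in the tree:

* `AlgFormExprCalculus`: `d(ξ.realize A) = (ξ.D).realize A` for the formal derivative `D`, which
  commutes with conjugation (`AlgFormExpr.conj_D`); so closedness of a realisation is the VANISHING
  of another realisation (`AlgFormExpr.realize_mem_cclosedSmoothForms_iff`) and it suffices to show
  that vanishing of realisations passes to conjugates (`AlgFormExpr.realize_conj_eq_zero`).
* `ConjRealizeReadout` + `SubmersivePresentationTwistedDerivation`: at a point `x ∈ Y^an` over an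
  affine open `V ∋ y = φ(x)` carrying a submersive presentation `Γ(Y, V) = ℂ[xᵢ]/(fⱼ)` of dimension
  `m` (Mathlib `SmoothOfRelativeDimension`), the value of a realised expression is
  `∑ₛ χ(aₛ) θ_{J_s}` where `θ_J` are the iterated wedges of the differentials of the FREE coordinates,
  `aₛ ∈ Γ(Y, V)` are the readout coefficients of the (restricted) expression — depending on the
  expression and the presentation only — and `χ` is evaluation at `y` (`readout_eq`, for the point
  derivation `s ↦ d(s ∘ φ)ₓ`, `AnalyticModel.isTwistedDerivation_mextDeriv_ofFun`);
  §1 below (`AnalyticModel.realize_apply_eq_sum_readout`) records this for any twisted reading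
  `ψ : Γ(Y, V) → Γ(X, U)` of the coordinates on any model.
* `AnalytificationCotangentChart` + `OneFormWedgeDeterminant`: the free coordinate differentials at
  `x` admit dual tangent vectors (Clements–Osgood), so the `θ_J` are linearly independent; hence a
  realisation VANISHING at `x` has `aₛ(y) = 0` for all `s` (§2,
  `AnalyticModel.eval_readoutCoeff_eq_zero_of_realize_apply_eq_zero`) — the injectivity of algebraic
  into analytic forms, read at one point.
* `ConjugateVarietyPointEval`: a point `x'` of `(Y^σ)^an` lies over `y' ∈ Y^σ(ℂ)`, under which lies
  `y ∈ Y(ℂ)` with `(π^* a)(y') = σ(a(y))`; reading the conjugate expression at `x'` through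
  `ψ = π^*` gives `∑ₛ σ(aₛ(y)) θ'_{J_s}` with the SAME `aₛ` (§3), which vanishes.

§4 records the consequence for the existence conjunct of `IsAbsoluteHodgeClass`: with (J)
(`jouanolou_cohomologyChart_holds`), (R) (`exists_isRational_complexDeRhamIsoFamily_holds`) and (C)
theorems, **conjugate classes exist from Grothendieck's comparison (G) alone**
(`exists_isConjugateClass_of_grothendieck`).

No new definitions, no named facts (net debt −1).

## References

* F. Charles, C. Schnell, *Notes on absolute Hodge classes*, in *Hodge Theory*, Math. Notes 49
  (2014), §11.2.2, (11.2.1)–(11.2.3).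
* J.-P. Serre, *Géométrie algébrique et géométrie analytique*, Ann. Inst. Fourier 6 (1956), §1 n°4,
  §2 n°5 Prop. 2, n°6 Prop. 3 Cor. 2.
* A. Grothendieck, *On the de Rham cohomology of algebraic varieties*, Publ. IHÉS 29 (1966), §1.
-/

noncomputable section

open scoped Manifold ContDiff Topology
open CategoryTheory AlgebraicGeometry Filter
open Literature.NumberTheory.Transcendental Literature.Geometry.Kaehler
open Literature.RingTheory.Derivation
open Literature.AlgebraicGeometry.Motives (AlgPoints)

namespace Literature.AlgebraicGeometry.HodgeTheory

section HodgeTheory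

variable {E : Type} [NormedAddCommGroup E] [NormedSpace ℂ E] [FiniteDimensional ℂ E]

/-! ### §0 Two bookkeeping lemmas (private) -/

omit [FiniteDimensional ℂ E] in
/-- The differential of a function `f` on a manifold charted on `E`, evaluated on one vector `v`,
is the derivative of `f` read in the chart at `x`: `d(f)ₓ(v) = D(f ∘ χₓ⁻¹)(χₓ x) v` (private helper).
[folklore] -/
private theorem mextDeriv_ofFun_apply_single {M : Type*} [TopologicalSpace M] [ChartedSpace E M]
    [IsManifold 𝓘(ℝ, E) ∞ M] (f : M → ℂ) (x : M) (v : E) :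
    (mextDeriv (MForm.ofFun 𝓘(ℝ, E) f) x : E [⋀^Fin 1]→L[ℝ] ℂ) ![v] =
      fderiv ℝ (fun z ↦ f ((chartAt E x).symm z)) (chartAt E x x) v := by
  rw [mextDeriv_ofFun_apply, ModelWithCorners.Boundaryless.range_eq_univ, fderivWithin_univ]
  rfl

/-- Restricting the pull-back `f^* g` of a global section to `f⁻¹V` is pulling back the restriction
`g|_V` (naturality of `f^*`; private helper). [folklore] -/
private theorem res_appTop_eq_app_res {X' X : Scheme} (f : X' ⟶ X) (V : X.Opens) (g : Γ(X, ⊤)) :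
    X'.presheaf.map (homOfLE (le_top : f ⁻¹ᵁ V ≤ ⊤)).op (f.appTop g) =
      f.app V (X.presheaf.map (homOfLE (le_top : V ≤ ⊤)).op g) := by
  have h := f.naturality (homOfLE (le_top : V ≤ ⊤)).op
  have h' := congrArg (fun φ ↦ φ.hom g) h
  simp only [CommRingCat.hom_comp, RingHom.coe_comp, Function.comp_apply] at h'
  exact h'.symm

/-! ### §1 The readout of a realisation at a point, through a twisted reading of coordinates -/

namespace AnalyticModel

variable {m : ℕ} {X : Motives.SchemeOver ℂ} (B : AnalyticModel E m X)

/-- **Readout of a realised expression at a point.** Let `B` be an analytic model of `X`,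
`x ∈ X^an` over the open `U`, `ψ : S →+* Γ(X, U)` a ring homomorphism from a submersively presented
`R₀`-algebra `S` (free variables reindexed by `ε : Fin N ≃ free`), `χ : S →+* ℂ` the values at `x`
(`(ψ s)(φ x) = χ s`) such that `s ↦ d((ψ s) ∘ φ)ₓ` is a `χ`-twisted derivation, and `η` a form
expression on `X` whose coefficients and arguments restrict on `U` to `ψ`-images `ψ(cⱼ)`,
`ψ(g_{j,l})`. Then at `x` the realisation of `η` is `∑ₛ χ(aₛ) · θ_{J_s}`, `aₛ ∈ S` the readout
coefficients of `(c, g)` and `θ_J` the iterated wedges of the differentials `d((ψ x_a) ∘ φ)ₓ` of the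
free coordinates along increasing `J` (`readout_eq`). [cite: SerreGAGA1956, §2 n°6 Prop. 3 Cor. 2] -/
theorem realize_apply_eq_sum_readout (U : X.left.Opens) {x : B.carrier}
    (hx : (B.toComplexPoints x).pt ∈ U) {S R₀ : Type*} [CommRing S] [CommRing R₀] [Algebra R₀ S]
    (ψ : S →+* Γ(X.left, U)) (χ : S →+* ℂ)
    (hχ : ∀ s, Motives.AlgPoints.evalOrZero U (ψ s) (B.toComplexPoints x) = χ s)
    (hD : IsTwistedDerivation R₀ χ (fun s ↦ (mextDeriv (MForm.ofFun 𝓘(ℝ, E) fun z ↦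
      Motives.AlgPoints.evalOrZero U (ψ s) (B.toComplexPoints z)) x : E [⋀^Fin 1]→L[ℝ] ℂ)))
    {ι τ : Type*} [Fintype ι] [Fintype τ] [DecidableEq ι] [DecidableEq τ]
    (Pres : Algebra.SubmersivePresentation R₀ S ι τ) {N : ℕ} (ε : Fin N ≃ Free Pres)
    {n : ℕ} (η : AlgFormExpr X n) (c : Fin η.size → S) (g : Fin η.size → Fin n → S)
    (hc : ∀ j, X.left.presheaf.map (homOfLE (le_top : U ≤ ⊤)).op (η.coef j) = ψ (c j))
    (hg : ∀ j l, X.left.presheaf.map (homOfLE (le_top : U ≤ ⊤)).op (η.arg j l) = ψ (g j l)) :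
    η.realize B x =
      (∑ s : Set.powersetCard (Fin N) n, χ (readoutCoeff Pres ε c g s) •
        ContinuousAlternatingMap.iterWedge (𝕜 := ℝ) (V := E) (A := ℂ) n
          ((fun a ↦ (mextDeriv (MForm.ofFun 𝓘(ℝ, E) fun z ↦
            Motives.AlgPoints.evalOrZero U (ψ (Pres.val (ε a).1)) (B.toComplexPoints z)) x :
              E [⋀^Fin 1]→L[ℝ] ℂ)) ∘ (Set.powersetCard.ofFinEmbEquiv.symm s)) :
          E [⋀^Fin n]→L[ℝ] ℂ) := by
  have hr := readout_eq (V₀ := E) Pres ε hD c g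
  rw [AlgFormExpr.realize_apply]
  refine Eq.trans (Finset.sum_congr rfl fun j _ ↦ ?_) hr
  have htop : (B.toComplexPoints x).pt ∈ (⊤ : X.left.Opens) := trivial
  have hcoef : B.regularFun (η.coef j) x = χ (c j) := by
    rw [← hχ, ← hc]
    simp only [AnalyticModel.regularFun]
    rw [Motives.AlgPoints.evalOrZero_of_mem _ htop, Motives.AlgPoints.evalOrZero_of_mem _ hx,
      Motives.AlgPoints.eval_res]
  have harg : ∀ l, dFun (B.regularFun (η.arg j l)) x =
      mextDeriv (MForm.ofFun 𝓘(ℝ, E) fun z ↦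
        Motives.AlgPoints.evalOrZero U (ψ (g j l)) (B.toComplexPoints z)) x := by
    intro l
    rw [← hg]
    exact B.mextDeriv_ofFun_evalOrZero_res (le_top : U ≤ ⊤) hx (η.arg j l)
  exact congrArg₂ (fun (r : ℂ) (θ : Fin n → TangentSpace 𝓘(ℝ, E) x [⋀^Fin 1]→L[ℝ] ℂ) ↦
    r • ContinuousAlternatingMap.iterWedge (𝕜 := ℝ) (V := E) (A := ℂ) n θ) hcoef (funext harg)

/-! ### §2 A realisation vanishing at a point has vanishing readout coefficients there -/

/-- **Injectivity of algebraic into analytic forms, at a point.** Let `A` be an analytic model of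
the smooth `ℂ`-scheme `Y` of relative dimension `m`, `V ⊆ Y` an affine open with a submersive
presentation of `Γ(Y, V)` over `Γ(Spec ℂ, 𝒪) = ℂ` of dimension `m`, `x ∈ Y^an` with `φ(x) ∈ V`,
and `η` a form expression on `Y` whose realisation VANISHES at `x`. Then all readout coefficients
`aₛ ∈ Γ(Y, V)` of `η|_V` vanish at `φ(x)`: the realisation at `x` reads `∑ₛ aₛ(φ x) θ_{J_s}`
(§1 with `ψ = id`), and the iterated wedges `θ_J` of the free coordinate differentials are linearly
independent because these differentials admit dual tangent vectors
(`IsAnalytification.exists_dual_fderiv_coord`, Clements–Osgood;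
`ContinuousAlternatingMap.linearIndependent_iterWedge_of_dual`).
[cite: SerreGAGA1956, §2 n°6 Prop. 3 Cor. 2 (with §1 n°4)] -/
theorem eval_readoutCoeff_eq_zero_of_realize_apply_eq_zero {Y : Motives.SchemeOver ℂ}
    [SmoothOfRelativeDimension m Y.hom] (A : AnalyticModel E m Y)
    {V : Y.left.Opens} (hV : IsAffineOpen V) (eV : V ≤ Y.hom ⁻¹ᵁ ⊤)
    [Algebra Γ(Spec (.of ℂ), ⊤) Γ(Y.left, V)]
    (halg : algebraMap Γ(Spec (.of ℂ), ⊤) Γ(Y.left, V) = (Y.hom.appLE ⊤ V eV).hom)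
    {ι τ : Type*} [Fintype ι] [Fintype τ] [DecidableEq ι] [DecidableEq τ]
    (Pres : Algebra.SubmersivePresentation Γ(Spec (.of ℂ), ⊤) Γ(Y.left, V) ι τ)
    (hdim : Pres.dimension = m) {N : ℕ} (ε : Fin N ≃ Free Pres)
    {x : A.carrier} (hx : (A.toComplexPoints x).pt ∈ V) {n : ℕ} (η : AlgFormExpr Y n)
    (h : η.realize A x = 0) (s : Set.powersetCard (Fin N) n) :
    (A.toComplexPoints x).eval V hx (readoutCoeff Pres ε
      (fun j ↦ Y.left.presheaf.map (homOfLE (le_top : V ≤ ⊤)).op (η.coef j))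
      (fun j l ↦ Y.left.presheaf.map (homOfLE (le_top : V ≤ ⊤)).op (η.arg j l)) s) = 0 := by
  classical
  haveI : Smooth Y.hom := SmoothOfRelativeDimension.smooth m Y.hom
  haveI : CompleteSpace ℂ := inferInstance
  -- evaluation at `φ x` and the point derivation `s ↦ d(s ∘ φ)ₓ` on `Γ(Y, V)`
  set χ : Γ(Y.left, V) →+* ℂ := (A.toComplexPoints x).evalRingHom V hx with hχdef
  have hχ : ∀ s : Γ(Y.left, V), Motives.AlgPoints.evalOrZero V ((RingHom.id _) s)
      (A.toComplexPoints x) = χ s := fun s ↦ by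
    rw [RingHom.id_apply, Motives.AlgPoints.evalOrZero_of_mem _ hx, hχdef,
      Motives.AlgPoints.evalRingHom_apply]
  have hO : IsOpen (A.toComplexPoints ⁻¹' {P | P.pt ∈ V}) := A.isAnalytification.isOpen_preimage V
  have hD : IsTwistedDerivation Γ(Spec (.of ℂ), ⊤) χ (fun s ↦ (mextDeriv (MForm.ofFun 𝓘(ℝ, E)
      fun z ↦ Motives.AlgPoints.evalOrZero V ((RingHom.id _) s) (A.toComplexPoints z)) x :
        E [⋀^Fin 1]→L[ℝ] ℂ)) := by
    refine A.isTwistedDerivation_mextDeriv_ofFun V hx (RingHom.id _) χ hχ (fun r ↦ ?_)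
    filter_upwards [hO.mem_nhds hx] with z hz
    rw [RingHom.id_apply, halg, Motives.AlgPoints.evalOrZero_of_mem _ hz,
      Motives.AlgPoints.evalOrZero_of_mem _ hx]
    exact ((A.toComplexPoints z).eval_appLE_top hz eV r).trans
      ((A.toComplexPoints x).eval_appLE_top hx eV r).symm
  -- the readout of the vanishing realisation
  have hsum := A.realize_apply_eq_sum_readout V hx (RingHom.id _) χ hχ hD Pres ε η
    (fun j ↦ Y.left.presheaf.map (homOfLE (le_top : V ≤ ⊤)).op (η.coef j))
    (fun j l ↦ Y.left.presheaf.map (homOfLE (le_top : V ≤ ⊤)).op (η.arg j l))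
    (fun j ↦ rfl) (fun j l ↦ rfl)
  rw [h] at hsum
  simp only [RingHom.id_apply] at hsum
  -- the free coordinate differentials and their dual vectors
  set θ : Fin N → (E [⋀^Fin 1]→L[ℝ] ℂ) := fun a ↦ (mextDeriv (MForm.ofFun 𝓘(ℝ, E) fun z ↦
      Motives.AlgPoints.evalOrZero V (Pres.val (ε a).1) (A.toComplexPoints z)) x :
        E [⋀^Fin 1]→L[ℝ] ℂ)
  obtain ⟨w, hw⟩ := A.isAnalytification.exists_dual_fderiv_coord hV eV halg Pres hdim hx
  have hθw : ∀ a b : Fin N, θ a ![w (ε b)] = if a = b then 1 else 0 := by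
    intro a b
    have h1 := hw (ε a) (ε b)
    simp only [EmbeddingLike.apply_eq_iff_eq] at h1
    rw [← h1]
    exact mextDeriv_ofFun_apply_single _ x (w (ε b))
  have hli := ContinuousAlternatingMap.linearIndependent_iterWedge_of_dual θ (fun b ↦ w (ε b)) hθw n
  have key := (Fintype.linearIndependent_iff.1 hli) (fun s ↦ χ (readoutCoeff Pres ε
      (fun j ↦ Y.left.presheaf.map (homOfLE (le_top : V ≤ ⊤)).op (η.coef j))
      (fun j l ↦ Y.left.presheaf.map (homOfLE (le_top : V ≤ ⊤)).op (η.arg j l)) s)) hsum.symm s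
  rw [hχdef, Motives.AlgPoints.evalRingHom_apply] at key
  exact key

end AnalyticModel

/-! ### §3 Vanishing of realisations passes to conjugates; the discharge of (C) -/

namespace AlgFormExpr

/-- **Vanishing realisations have vanishing conjugates.** For `Y` smooth over `ℂ` of relative
dimension `m` (affine in the application), analytic models `A` of `Y` and `A'` of `Y^σ`, and a form
expression `η` on `Y` (coefficients and arguments global regular functions) with
`η.realize A = 0`, also `(η^σ).realize A' = 0`. At `x' ∈ (Y^σ)^an` over `y' ∈ Y^σ(ℂ)` let
`y ∈ Y(ℂ)` be the point under `y'` (`AlgPoints.ofConjugate`) and `V ∋ y` an affine open with a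
standard smooth presentation (Mathlib `SmoothOfRelativeDimension`); by §2 the readout coefficients
`aₛ` of `η|_V` vanish at `y`, and by §1 — reading the coordinates on `Y^σ` through `π^*`, whose values
at `y'` are `σ(a(y))` (`AlgPoints.evalOrZero_app_conjFst`) — the conjugate realisation at `x'` is
`∑ₛ σ(aₛ(y)) θ'_{J_s} = 0`. [cite: CharlesSchnell2014Notes, §11.2.2 (11.2.2)] -/
theorem realize_conj_eq_zero (σ : ℂ ≃+* ℂ) {m : ℕ} {Y : Motives.SchemeOver ℂ}
    [SmoothOfRelativeDimension m Y.hom] (A : AnalyticModel E m Y)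
    (A' : AnalyticModel E m (Motives.conjugateVariety σ Y)) {n : ℕ} (η : AlgFormExpr Y n)
    (h : η.realize A = 0) : (η.conj σ).realize A' = 0 := by
  classical
  funext x'
  rw [Pi.zero_apply]
  -- the point `y` of `Y` under `y' = φ'(x')`, and a point `x` of `Y^an` over it
  obtain ⟨x, hx⟩ : ∃ x : A.carrier, A.toComplexPoints x =
      Motives.AlgPoints.ofConjugate σ Y (A'.toComplexPoints x') :=
    ⟨A.homeomorph.symm _, A.homeomorph.apply_symm_apply _⟩
  -- a standard smooth chart of `Y` at `y`
  obtain ⟨U', -, V, hV, hxV, eVU, hstd⟩ :=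
    SmoothOfRelativeDimension.exists_isStandardSmoothOfRelativeDimension (n := m) (f := Y.hom)
      (A.toComplexPoints x).pt
  obtain rfl : U' = ⊤ := by
    refine eq_top_iff.2 fun p _ ↦ ?_
    have hp : Y.hom.base (A.toComplexPoints x).pt ∈ U' := eVU hxV
    rwa [Subsingleton.elim p (Y.hom.base (A.toComplexPoints x).pt)]
  letI alg : Algebra Γ(Spec (.of ℂ), ⊤) Γ(Y.left, V) := (Y.hom.appLE ⊤ V eVU).hom.toAlgebra
  have halg : algebraMap Γ(Spec (.of ℂ), ⊤) Γ(Y.left, V) = (Y.hom.appLE ⊤ V eVU).hom := rfl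
  obtain ⟨ι, τ, _, _, Pres, hdim⟩ := hstd.toAlgebra.out
  cases nonempty_fintype ι
  cases nonempty_fintype τ
  set N : ℕ := Fintype.card (Free Pres)
  set ε : Fin N ≃ Free Pres := (Fintype.equivFin (Free Pres)).symm
  -- the restricted coefficients and arguments of `η`
  set c : Fin η.size → Γ(Y.left, V) :=
    fun j ↦ Y.left.presheaf.map (homOfLE (le_top : V ≤ ⊤)).op (η.coef j)
  set g : Fin η.size → Fin n → Γ(Y.left, V) :=
    fun j l ↦ Y.left.presheaf.map (homOfLE (le_top : V ≤ ⊤)).op (η.arg j l)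
  -- (§2) the readout coefficients vanish at `y`
  have hcoef : ∀ s : Set.powersetCard (Fin N) n,
      (A.toComplexPoints x).eval V hxV (readoutCoeff Pres ε c g s) = 0 := fun s ↦
    A.eval_readoutCoeff_eq_zero_of_realize_apply_eq_zero hV eVU halg Pres hdim ε hxV η
      (by rw [h, Pi.zero_apply]) s
  -- (§1 on `Y^σ`) the conjugate realisation at `x'`, read through `ψ = π^*`
  have hyV : (Motives.AlgPoints.ofConjugate σ Y (A'.toComplexPoints x')).pt ∈ V := hx ▸ hxV
  have hy'V : (A'.toComplexPoints x').pt ∈ Motives.AlgPoints.conjFst σ Y ⁻¹ᵁ V :=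
    (Motives.AlgPoints.pt_ofConjugate_mem_iff _ V).1 hyV
  set ψ : Γ(Y.left, V) →+*
      Γ((Motives.conjugateVariety σ Y).left, Motives.AlgPoints.conjFst σ Y ⁻¹ᵁ V) :=
    ((Motives.AlgPoints.conjFst σ Y).app V).hom
  set χ' : Γ(Y.left, V) →+* ℂ :=
    σ.toRingHom.comp ((A.toComplexPoints x).evalRingHom V hxV)
  have hχ'ap : ∀ s, χ' s = σ ((A.toComplexPoints x).eval V hxV s) := fun s ↦ rfl
  have hval : ∀ s, Motives.AlgPoints.evalOrZero (Motives.AlgPoints.conjFst σ Y ⁻¹ᵁ V) (ψ s)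
      (A'.toComplexPoints x') = χ' s := by
    intro s
    rw [hχ'ap]
    change Motives.AlgPoints.evalOrZero _ ((Motives.AlgPoints.conjFst σ Y).app V s) _ = _
    rw [Motives.AlgPoints.evalOrZero_app_conjFst, ← hx, Motives.AlgPoints.evalOrZero_of_mem _ hxV]
  have hO : IsOpen (A'.toComplexPoints ⁻¹' {P | P.pt ∈ Motives.AlgPoints.conjFst σ Y ⁻¹ᵁ V}) :=
    A'.isAnalytification.isOpen_preimage _
  have hD' : IsTwistedDerivation Γ(Spec (.of ℂ), ⊤) χ' (fun s ↦ (mextDeriv (MForm.ofFun 𝓘(ℝ, E)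
      fun z ↦ Motives.AlgPoints.evalOrZero (Motives.AlgPoints.conjFst σ Y ⁻¹ᵁ V) (ψ s)
        (A'.toComplexPoints z)) x' : E [⋀^Fin 1]→L[ℝ] ℂ)) := by
    refine A'.isTwistedDerivation_mextDeriv_ofFun _ hy'V ψ χ' hval (fun r ↦ ?_)
    filter_upwards [hO.mem_nhds hy'V] with z hz
    rw [halg]
    change Motives.AlgPoints.evalOrZero _
        ((Motives.AlgPoints.conjFst σ Y).app V ((Y.hom.appLE ⊤ V eVU).hom r))
          (A'.toComplexPoints z) =
      Motives.AlgPoints.evalOrZero _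
        ((Motives.AlgPoints.conjFst σ Y).app V ((Y.hom.appLE ⊤ V eVU).hom r))
          (A'.toComplexPoints x')
    rw [Motives.AlgPoints.evalOrZero_app_conjFst, Motives.AlgPoints.evalOrZero_app_conjFst,
      Motives.AlgPoints.evalOrZero_of_mem _ ((Motives.AlgPoints.pt_ofConjugate_mem_iff _ V).2 hz),
      Motives.AlgPoints.evalOrZero_of_mem _ hyV]
    exact congrArg σ (((Motives.AlgPoints.ofConjugate σ Y (A'.toComplexPoints z)).eval_appLE_top
      _ eVU r).trans ((Motives.AlgPoints.ofConjugate σ Y (A'.toComplexPoints x')).eval_appLE_top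
        hyV eVU r).symm)
  have hsum := A'.realize_apply_eq_sum_readout (Motives.AlgPoints.conjFst σ Y ⁻¹ᵁ V) hy'V ψ χ'
    hval hD' Pres ε (η.conj σ) c g
    (fun j ↦ res_appTop_eq_app_res (Motives.AlgPoints.conjFst σ Y) V (η.coef j))
    (fun j l ↦ res_appTop_eq_app_res (Motives.AlgPoints.conjFst σ Y) V (η.arg j l))
  rw [hsum]
  refine Finset.sum_eq_zero fun s _ ↦ ?_
  have h0 : χ' (readoutCoeff Pres ε c g s) = 0 :=
    (hχ'ap _).trans ((congrArg σ (hcoef s)).trans (map_zero σ))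
  exact (congrArg (fun r : ℂ ↦ r • _) h0).trans (zero_smul ℂ _)

end AlgFormExpr

/-- **Conjugation preserves closedness of algebraic forms** (discharge of the named fact (C)
`conj_realize_mem_cclosedSmoothForms` of `ConjugationChartExistence`). For `Y` smooth affine over
`ℂ`, analytic models `A` of `Y` and `A'` of `Y^σ`, and an algebraic `k`-form expression `ξ` on `Y`:
if `ξ.realize A` is closed then `(ξ^σ).realize A'` is closed. Proof: `d(ξ.realize A) = (Dξ).realize A`
and `(Dξ)^σ = D(ξ^σ)` (`AlgFormExprCalculus`), so closedness is the vanishing of the realisation of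
`Dξ`, which passes to the conjugate (`AlgFormExpr.realize_conj_eq_zero`). This is Charles–Schnell's
"`α ↦ α^σ` is an isomorphism of algebraic de Rham complexes" combined with the injectivity of
algebraic into analytic forms on a smooth variety. [cite: CharlesSchnell2014Notes, §11.2.2 (11.2.2)] -/
theorem conj_realize_mem_cclosedSmoothForms_holds : conj_realize_mem_cclosedSmoothForms := by
  intro σ m Y _ _ E _ _ _ A A' k ξ hξ
  rw [AlgFormExpr.realize_mem_cclosedSmoothForms_iff] at hξ ⊢
  rw [← AlgFormExpr.conj_D]
  exact AlgFormExpr.realize_conj_eq_zero σ A A' ξ.D hξ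

/-! ### §4 Conjugate classes exist from Grothendieck's comparison alone -/

/-- **Conjugate classes exist from (G) alone.** For `X` smooth projective over `ℂ`, `σ ∈ Aut ℂ`,
`k` and `c ∈ Hᵏ(X(ℂ); ℂ)` there is a class `c' ∈ Hᵏ(X^σ(ℂ); ℂ)` conjugate to `c`
(`IsConjugateClass σ X k c c'`, the existence conjunct of `IsAbsoluteHodgeClass`) as soon as
Grothendieck's comparison (G) `grothendieck_comparison_realize_surjective` holds: of the four printed
inputs of `ConjugationChartExistence`, (J) (`jouanolou_cohomologyChart_holds`), (R)
(`exists_isRational_complexDeRhamIsoFamily_holds`) and (C) (`conj_realize_mem_cclosedSmoothForms_holds`)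
are now theorems. [cite: CharlesSchnell2014Notes, §11.2.2 (11.2.3)] -/
theorem exists_isConjugateClass_of_grothendieck (hG : grothendieck_comparison_realize_surjective) :
    ∀ ⦃n : ℕ⦄ ⦃X : Motives.SchemeOver ℂ⦄, Motives.IsSmoothProjective n X →
      ∀ (σ : ℂ ≃+* ℂ) (k : ℕ) (c : complexBetti X k), ∃ c', IsConjugateClass σ X k c c' :=
  exists_isConjugateClass_of_comparison hG conj_realize_mem_cclosedSmoothForms_holds

end HodgeTheory

end Literature.AlgebraicGeometry.HodgeTheory

end
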